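import Literature.AlgebraicGeometry.AbelianSchemes.WeilPairingCharacter
import Literature.AlgebraicGeometry.AbelianSchemes.WeilUnitNondegeneracy
import Literature.AlgebraicGeometry.AbelianSchemes.WeilUnitKernelOrthogonal
import Literature.AlgebraicGeometry.AbelianSchemes.WeilDualityPolarizationTransport
import Literature.AlgebraicGeometry.GroupSchemes.CartierDualCharacterIso
import HarnessLib

/-!
# The Weil homomorphism `w : Â[n] → (A[n])^D` of realisations: existence, trivial kernel, naturality
# ([Mumford AV] §20 pp. 184–186, §15 Thm. 1; [Tate 1997] §(3.8))

Topic `Literature/AlgebraicGeometry/AbelianSchemes`; namespace `Literature.AlgebraicGeometry.AbelianSchemes.WeilPairing`.  THEOREMS ONLY (no definition,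
no named fact, no instance, no notation, no `sorry`).  Cell `hodgecm-mathlib` (D-0151), FLOOR 0, P6 «MOD programme» (crux hLiu418 = stmt-HodgeConjecture-24832),
W-line `Cruxes/HLiu418/Lines/F0_P6b_WeilCartierDuality.lean` letter `stub_W1` «WeilPairingNatural», σ1 road step **(σ1-f2)** — the ASSEMBLY of the ★ organs
(σ1-a) B-p04 `CartierDualCharacter{Points,Yoneda,YonedaHom,Iso}` · (σ1-b)∕(σ1-f1) `WeilUnitOfTorsionPoint`∕`WeilPairingCharacter` · (σ1-c) B-p18 `WeilUnitMulRight` ·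
(σ1-d) `WeilUnitNondegeneracy` · (σ1-e) A-p03 `WeilUnitDualIsogeny` (LEAD F0P6-plan (g2) M-17v∕M-17v′; B-p08 (g32) HANDOVER memo).  Binders are the W-line՚s:
`A : AbelianVariety k`, a dual pair `D = (Â, 𝒫)` of `(AbelianScheme.ofAbelianVariety A).toOver` with the unit hypothesis `hD`, realisations `j : G ↪ A` of
`A[n]` and `ĵ : Ĝ ↪ Â` of `Â[n]` by ALL `T`-points (`hG`, `hĜ`, `[n] = n • 𝟙`), here for a general `n`.  The Weil homomorphism is NOT named: every
statement is about an arbitrary `w : Ĝ ⟶ G^D` with the pairing formula `hw` (the W-line takes `Classical.choose` of §2∕(σ1-f3)).  HC_CM is proved only modulo the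
printed citations until rung 0 closes; nothing here is about HC.

THE PRINT.  [MumfordAV1970] §20 p. 184: «for `x ∈ X_n` … `e_n(x, ·)`; the map `X̂_n → Hom(X_n, 𝔾_m)` … is injective» (here: the scheme-theoretic map
`ŷ ↦ e_n(·, ŷ)`, `Â[n] → (A[n])^D`, is a MONOMORPHISM); p. 186 (I): «`e_n(f(x), ŷ) = e_n(x, f̂(ŷ))`» (naturality against the dual homomorphism); §15 Thm. 1
(p. 143).  [Tate1997FiniteFlatGroupSchemes] §(3.8): `G^D(S) = Hom_{S-gr}(G_S, 𝔾_{m,S})`.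

* §1 `comp_zsmul_id_hom_eq_pow` (`t ≫ [n]_B = t ^ n`, ★ `AbelianVariety.hom_zsmul_id`), `comp_zsmul_id_hom_eq_pow'` (abelian `k`-schemes),
  `comp_pow_eq_one`∕`comp_pow_eq_one'` (points of the realisations are `n`-torsion);
* §2 **`exists_weilHom`** — a HOMOMORPHISM `w : Ĝ ⟶ G^D` with `⟪y ≫ w, x⟫ = χ(y ≫ ĵ, x ≫ j)` on finite points (★ `exists_hom_cartierDual_of_character_of_finite`
  fed with ★ `weilChar` and its four laws);
* §3 **`eq_one_of_comp_weilHom_eq_one`** — TRIVIAL KERNEL on finite points (`n ≠ 0`): the pairing values of `y ≫ w` vanish, in particular the Weil character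
  of `ŷ = y ≫ ĵ` against the universal torsion section `x₀′` over `T′ = A_T[n]` (a point of `G` by `hG`; `T′ ≅ Spec Γ(T′)` finite over `k`, ★ `isoSpecOver`), which
  read back over `T′` (★ `weilUnit_baseChange`, ★ `weilUnit_congr_base`) is the hypothesis of ★ (σ1-d) `eq_one_of_weilUnit_torsionTautSection'_eq_one` ⇒ `ŷ = 1`;
* §4 `eq_one_of_comp_weilHom_eq_one'` (all `T`-points, ★ `comp_eq_one_of_forall_finite`), **`mono_weilHom`**;
* §5 **`weilHom_natural`** — `βd ≫ w_A = w_B ≫ β^D` for `φ : A → B`, lifts `β` of `φ`, `βd` of `φ^∨` (★ `dualIsogenyOver`), normalised `DA`, `DB`: pairing values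
  `e^A(x, φ^∨ŷ)` vs `⟪·, x ≫ β⟫ = e^B(φx, ŷ)` (★ `cartierPairing_comp_cartierDualMap`, ★ (σ1-e) `weilUnit_comp_dualIsogenyOver`, ★ `ptSection_comp_baseChangeHom`),
  separation ★ `hom_cartierDual_ext_of_finite` — the `IsNatural`.2 square of the W-line verbatim.

## References
* [MumfordAV1970] D. Mumford, *Abelian Varieties* (1970), §20 (pp. 184–186), §15 Thm. 1 (p. 143).
* [Tate1997FiniteFlatGroupSchemes] J. Tate, *Finite flat group schemes* (1997), §(3.7)–(3.8) pp. 145–146.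
* [GortzWedhorn2020] U. Görtz, T. Wedhorn, *Algebraic Geometry I*, 2nd ed. (2020), Definition 4.45 (2) (p. 117).
* [GortzWedhorn2023] U. Görtz, T. Wedhorn, *Algebraic Geometry II* (2023), (27.35.1).
-/

set_option autoImplicit false

noncomputable section

-- `TopCat.Presheaf`/`Scheme.Modules` and the `Over`/`Scheme` wrappers are not reducible (as in ★ `WeilUnitOfTorsionPoint`, ★ `GroupSchemes/*`).
set_option backward.isDefEq.respectTransparency false

universe u

open CategoryTheory CategoryTheory.Limits AlgebraicGeometry MonoidalCategory CartesianMonoidalCategory TopologicalSpace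
  Opposite
open scoped MonObj

namespace Literature.AlgebraicGeometry.AbelianSchemes.WeilPairing

open Literature.AlgebraicGeometry.GroupSchemes Literature.AlgebraicGeometry.GroupSchemes.AffineGroupScheme
open Literature.AlgebraicGeometry.Motives Literature.AlgebraicGeometry.Motives.AbelianVariety
open Literature.AlgebraicGeometry.AbelianSchemes.AbelianSchemeOver Literature.AlgebraicGeometry.AbelianSchemes.AbelianSchemeOver.DualPair
open scoped CategoryTheory.Obj

variable {k : Type u} [Field k]

/-! ## §1 Torsion on points: `t ≫ [n]_B = t ^ n` -/

/-- **`t ≫ [n]_B = t ^ n`** for a `T`-point `t` of an abelian variety `B` (`[n]_B = n • 𝟙 B` read on the underlying group scheme, ★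
`AbelianVariety.hom_zsmul_id`). [cite: GortzWedhorn2023, (27.35.1)] -/
theorem comp_zsmul_id_hom_eq_pow (B : AbelianVariety k) {T : SchemeOver k} (t : T ⟶ B.X) (n : ℕ) :
    t ≫ (((n : ℕ) : ℤ) • 𝟙 B).hom.hom.hom = t ^ n := by
  rw [AbelianVariety.hom_zsmul_id, GrpObj.comp_zpow, Category.comp_id, zpow_natCast]

/-- The same for an abelian `k`-scheme `B` read as an abelian variety (★ `toAbelianVariety`; the underlying group scheme is `B.X` on the nose).
[cite: GortzWedhorn2023, (27.35.1)] -/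
theorem comp_zsmul_id_hom_eq_pow' (B : AbelianSchemeOver (Spec (CommRingCat.of k))) {T : SchemeOver k} (t : T ⟶ B.X) (n : ℕ) :
    t ≫ (((n : ℕ) : ℤ) • 𝟙 B.toAffine.toAbelianVariety).hom.hom.hom = t ^ n :=
  comp_zsmul_id_hom_eq_pow B.toAffine.toAbelianVariety t n

section Setting

variable (n : ℕ) (A : AbelianVariety k) (D : (AbelianScheme.ofAbelianVariety A).toOver.DualPair)
  (hD : Nonempty ((Scheme.Modules.pullback (DualPair.unitHatSlice D)).obj D.P ≅ SheafOfModules.unit _))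
  (G : SchemeOver k) [GrpObj G] [IsCommMonObj G] [IsAffine G.left] [Module.Free k (Alg G)] [Module.Finite k (Alg G)]
  (j : G ⟶ A.X) [IsMonHom j]
  (hG : ∀ ⦃T : SchemeOver k⦄ (t : T ⟶ A.X), (∃ s : T ⟶ G, s ≫ j = t) ↔ t ≫ ((((n : ℕ) : ℤ) • 𝟙 A).hom.hom.hom) = 1)
  (Ĝ : SchemeOver k) [GrpObj Ĝ] [IsAffine Ĝ.left] [Module.Finite k (Alg Ĝ)]
  (ĵ : Ĝ ⟶ D.hat.X) [IsMonHom ĵ]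
  (hĜ : ∀ ⦃T : SchemeOver k⦄ (t : T ⟶ D.hat.X),
    (∃ s : T ⟶ Ĝ, s ≫ ĵ = t) ↔ t ≫ ((((n : ℕ) : ℤ) • 𝟙 D.hat.toAffine.toAbelianVariety).hom.hom.hom) = 1)

omit [GrpObj G] [IsCommMonObj G] [IsAffine G.left] [Module.Free k (Alg G)] [Module.Finite k (Alg G)] [IsMonHom j] in
include hG in
/-- Points of a realisation `j : G ↪ A` of `A[n]` are `n`-torsion: `(x ≫ j) ^ n = 1`. [cite: MumfordAV1970, §20 (p. 184)] -/
theorem comp_pow_eq_one {T : SchemeOver k} (x : T ⟶ G) : (x ≫ j) ^ n = 1 := by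
  rw [← comp_zsmul_id_hom_eq_pow]
  exact (hG (x ≫ j)).1 ⟨x, rfl⟩

omit [GrpObj Ĝ] [IsAffine Ĝ.left] [Module.Finite k (Alg Ĝ)] [IsMonHom ĵ] in
include hĜ in
/-- Points of a realisation `ĵ : Ĝ ↪ Â` of `Â[n]` are `n`-torsion: `(y ≫ ĵ) ^ n = 1`. [cite: MumfordAV1970, §20 (p. 184)] -/
theorem comp_pow_eq_one' {T : SchemeOver k} (y : T ⟶ Ĝ) : (y ≫ ĵ) ^ n = 1 := by
  rw [← comp_zsmul_id_hom_eq_pow' D.hat]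
  exact (hĜ (y ≫ ĵ)).1 ⟨y, rfl⟩

/-! ## §2 The Weil homomorphism `w : Ĝ ⟶ G^D` with `⟪y ≫ w, x⟫ = χ(y ≫ ĵ, x ≫ j)` -/

include hG hĜ in
/-- **THE WEIL HOMOMORPHISM EXISTS: a homomorphism of group schemes `w : Ĝ ⟶ G^D` whose canonical pairing values on FINITE points are the Weil
characters, `⟪y ≫ w, x⟫ = e_n(x ≫ j, y ≫ ĵ)`** — B-p04՚s Yoneda form of `G^D(S) = Hom(G_S, 𝔾_m)` (★ `exists_hom_cartierDual_of_character_of_finite`)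
fed with the character family ★ `weilChar` and its four laws (★ `weilChar_naturality ∕ _mul_right ∕ _one_right ∕ _mul_left`).  `w` is unique (★
`hom_cartierDual_ext_of_finite`).  [MumfordAV1970] §20 p. 184: «`x ↦ e_n(x, ·)` … `X̂_n → Hom(X_n, 𝔾_m)`».
[cite: MumfordAV1970, §20 (p. 184), §15 Thm. 1 (p. 143)] [cite: Tate1997FiniteFlatGroupSchemes, §(3.8) p. 145] -/
theorem exists_weilHom : ∃ w : Ĝ ⟶ cartierDual G, IsMonHom w ∧
    ∀ ⦃T : Type u⦄ [CommRing T] [Algebra k T] [Module.Finite k T] (y : specOver k T ⟶ Ĝ) (x : specOver k T ⟶ G),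
      cartierPairing G (y ≫ w) x =
        D.weilChar hD n (y ≫ ĵ) (comp_pow_eq_one' n A D Ĝ ĵ hĜ y) (x ≫ j) (comp_pow_eq_one n A G j hG x) := by
  haveI : IsFinite Ĝ.hom := isFinite_hom_of_finite_alg Ĝ
  refine exists_hom_cartierDual_of_character_of_finite G (Y := Ĝ)
    (fun T _ _ y x => D.weilChar hD n (y ≫ ĵ) (comp_pow_eq_one' n A D Ĝ ĵ hĜ y) (x ≫ j) (comp_pow_eq_one n A G j hG x))
    (fun T _ _ T' _ _ _ _ θ y x => ?_) (fun T _ _ _ y x₁ x₂ => ?_) (fun T _ _ _ y => ?_) (fun T _ _ _ y₁ y₂ x => ?_)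
  · -- naturality in the test ring
    have hy' : (AlgPoints.specOverMapOfAlgHom θ ≫ y ≫ ĵ) ^ n = 1 := by
      rw [← Category.assoc]; exact comp_pow_eq_one' n A D Ĝ ĵ hĜ _
    have hx' : (AlgPoints.specOverMapOfAlgHom θ ≫ x ≫ j) ^ n = 1 := by
      rw [← Category.assoc]; exact comp_pow_eq_one n A G j hG _
    rw [D.weilChar_congr hD n (Category.assoc _ y ĵ) _ hy' (Category.assoc _ x j) _ hx']
    exact D.weilChar_naturality hD n θ (y ≫ ĵ) _ (x ≫ j) _ hy' hx'
  · -- multiplicative in `x`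
    rw [D.weilChar_congr hD n rfl _ (comp_pow_eq_one' n A D Ĝ ĵ hĜ y) (MonObj.mul_comp x₁ x₂ j) _
      (by rw [← MonObj.mul_comp]; exact comp_pow_eq_one n A G j hG _)]
    exact D.weilChar_mul_right hD n (y ≫ ĵ) _ (x₁ ≫ j) (x₂ ≫ j) _ _ _
  · -- unital in `x`
    rw [D.weilChar_congr hD n rfl _ (comp_pow_eq_one' n A D Ĝ ĵ hĜ y) (MonObj.one_comp j) _ (one_pow n)]
    exact D.weilChar_one_right hD n (y ≫ ĵ) _ _
  · -- multiplicative in `y`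
    rw [D.weilChar_congr hD n (MonObj.mul_comp y₁ y₂ ĵ) _ (by rw [← MonObj.mul_comp]; exact comp_pow_eq_one' n A D Ĝ ĵ hĜ _)
      rfl _ (comp_pow_eq_one n A G j hG x)]
    exact D.weilChar_mul_left hD n (y₁ ≫ ĵ) (y₂ ≫ ĵ) _ _ _ (x ≫ j) _

/-! ## §3 The kernel of `w` is trivial ((σ1-d) non-degeneracy) -/

omit [IsMonHom j] [IsAffine Ĝ.left] [Module.Finite k (Alg Ĝ)] in
include hG hĜ in
/-- **THE WEIL HOMOMORPHISM HAS TRIVIAL KERNEL ON FINITE POINTS**: if `y ≫ w = 1` for a point `y` of `Ĝ` over a finite `k`-algebra `T`, then `y = 1`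
(`n ≠ 0`, `ĵ` a monomorphism).  All pairing values of `y ≫ w` are `1`; in particular the Weil character of `ŷ := y ≫ ĵ` against the UNIVERSAL `n`-torsion
section `x₀′` over `T′ := A_T[n]` (★ `torsionTautSection'`; `T′` is finite over `Spec T`, hence `Spec` of a finite `k`-algebra `Γ(T′)`, ★ `isoSpecOver`, and
`x₀′` is a point of `G` there by `hG`) is `1`; reading it back over `T′` (★ `weilUnit_baseChange` along `Spec Γ(T′) ≅ T′`, ★ `weilUnit_congr_base`) gives the
hypothesis of ★ (σ1-d) `eq_one_of_weilUnit_torsionTautSection'_eq_one`, whence `ŷ = 1`. [cite: MumfordAV1970, §20 (p. 184)]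
[cite: MumfordAV1970, §15 Thm. 1 (p. 143)] [cite: Tate1997FiniteFlatGroupSchemes, §(3.8) p. 145] -/
theorem eq_one_of_comp_weilHom_eq_one (hn : n ≠ 0) [Mono ĵ] (w : Ĝ ⟶ cartierDual G)
    (hw : ∀ ⦃T : Type u⦄ [CommRing T] [Algebra k T] [Module.Finite k T] (y : specOver k T ⟶ Ĝ) (x : specOver k T ⟶ G),
      cartierPairing G (y ≫ w) x =
        D.weilChar hD n (y ≫ ĵ) (comp_pow_eq_one' n A D Ĝ ĵ hĜ y) (x ≫ j) (comp_pow_eq_one n A G j hG x))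
    {T : Type u} [CommRing T] [Algebra k T] [Module.Finite k T] (y : specOver k T ⟶ Ĝ) (hy : y ≫ w = 1) : y = 1 := by
  -- it suffices that `ŷ := y ≫ ĵ = 1`
  suffices hc : y ≫ ĵ = 1 by rw [← cancel_mono ĵ, hc, MonObj.one_comp]
  haveI : IsLocallyNoetherian (Spec (CommRingCat.of T)) := isLocallyNoetherian_spec_of_finite (k := k) T
  haveI : IsLocallyNoetherian (specOver k T).left := ‹IsLocallyNoetherian (Spec (CommRingCat.of T))›
  haveI : IsCommMonObj ((AbelianScheme.ofAbelianVariety A).toOver.baseChange (specOver k T).hom).X :=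
    isCommMonObj_baseChange_of_field _
  haveI : IsCommMonObj ((AbelianScheme.ofAbelianVariety A).toOver.baseChange
      ((((AbelianScheme.ofAbelianVariety A).toOver.baseChange (specOver k T).hom).torsion n).hom ≫ (specOver k T).hom)).X :=
    isCommMonObj_baseChange_of_field _
  refine D.eq_one_of_weilUnit_torsionTautSection'_eq_one hD n (specOver k T).hom (y ≫ ĵ) (comp_pow_eq_one' n A D Ĝ ĵ hĜ y) hn ?_
  intro _
  -- `T′ := A_T[n]` over `Spec k`: affine, finite
  haveI : IsFinite (((AbelianScheme.ofAbelianVariety A).toOver.baseChange (specOver k T).hom).torsion n).hom :=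
    isFinite_torsion_hom _ hn
  haveI : IsAffine (specOver k T).left := isAffine_specOver_left T
  haveI : IsAffine (((AbelianScheme.ofAbelianVariety A).toOver.baseChange (specOver k T).hom).torsion n).left :=
    isAffine_of_isAffineHom (((AbelianScheme.ofAbelianVariety A).toOver.baseChange (specOver k T).hom).torsion n).hom
  haveI : Module.Finite k (Alg (specOver k T)) := Module.Finite.equiv (algSpecOverEquiv (R := k) T).symm.toLinearEquiv
  haveI : IsFinite (specOver k T).hom := isFinite_hom_of_finite_alg (specOver k T)
  -- the universal torsion section `x₀′` over `T′` is a point of `G` (by `hG`)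
  have hx₀ := (AbelianScheme.ofAbelianVariety A).toOver.torsionTautSection'_mem n (specOver k T).hom
  have hpt : (AbelianScheme.ofAbelianVariety A).toOver.sectionToPointHom
      ((((AbelianScheme.ofAbelianVariety A).toOver.baseChange (specOver k T).hom).torsion n).hom ≫ (specOver k T).hom)
      ((AbelianScheme.ofAbelianVariety A).toOver.torsionTautSection' n (specOver k T).hom) ^ n = 1 := by
    rw [← map_pow, (AbelianScheme.ofAbelianVariety A).toOver.torsionTautSection'_pow n (specOver k T).hom, map_one]
  obtain ⟨s, hs⟩ := (hG ((AbelianScheme.ofAbelianVariety A).toOver.sectionToPointHom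
      ((((AbelianScheme.ofAbelianVariety A).toOver.baseChange (specOver k T).hom).torsion n).hom ≫ (specOver k T).hom)
      ((AbelianScheme.ofAbelianVariety A).toOver.torsionTautSection' n (specOver k T).hom))).2
    ((comp_zsmul_id_hom_eq_pow A _ n).trans hpt)
  -- `W := T′` as an affine `k`-scheme, `Spec` of the finite `k`-algebra `T₁ := Γ(T′)`
  obtain ⟨W, hW⟩ : ∃ W : SchemeOver k,
      W = Over.mk ((((AbelianScheme.ofAbelianVariety A).toOver.baseChange (specOver k T).hom).torsion n).hom ≫ (specOver k T).hom) :=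
    ⟨_, rfl⟩
  haveI : IsAffine W.left := by rw [hW]; exact ‹IsAffine (((AbelianScheme.ofAbelianVariety A).toOver.baseChange (specOver k T).hom).torsion n).left›
  haveI : IsFinite W.hom := by rw [hW]; exact inferInstanceAs (IsFinite ((((AbelianScheme.ofAbelianVariety A).toOver.baseChange
    (specOver k T).hom).torsion n).hom ≫ (specOver k T).hom))
  haveI : Module.Finite k (Alg W) := Alg.moduleFinite W
  haveI : IsLocallyNoetherian (Spec (CommRingCat.of (Alg W))) := isLocallyNoetherian_spec_of_finite (k := k) (Alg W)
  haveI : IsLocallyNoetherian (specOver k (Alg W)).left := ‹IsLocallyNoetherian (Spec (CommRingCat.of (Alg W)))›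
  haveI : IsCommMonObj ((AbelianScheme.ofAbelianVariety A).toOver.baseChange (specOver k (Alg W)).hom).X :=
    isCommMonObj_baseChange_of_field _
  subst hW
  -- `t : Spec T₁ ≅ T′` and the test points `y₁ := t ≫ (T′ → Spec T) ≫ y`, `x₁ := t ≫ x₀′`
  haveI : IsIso (isoSpecOver (Over.mk ((((AbelianScheme.ofAbelianVariety A).toOver.baseChange (specOver k T).hom).torsion n).hom ≫
      (specOver k T).hom))).inv.left := inferInstanceAs (IsIso ((Over.forget _).map (isoSpecOver _).inv))
  haveI : IsCommMonObj ((AbelianScheme.ofAbelianVariety A).toOver.baseChange ((isoSpecOver (Over.mk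
      ((((AbelianScheme.ofAbelianVariety A).toOver.baseChange (specOver k T).hom).torsion n).hom ≫ (specOver k T).hom))).inv.left ≫
      (((AbelianScheme.ofAbelianVariety A).toOver.baseChange (specOver k T).hom).torsion n).hom ≫ (specOver k T).hom)).X :=
    isCommMonObj_baseChange_of_field _
  have h1 := hw ((isoSpecOver (Over.mk ((((AbelianScheme.ofAbelianVariety A).toOver.baseChange (specOver k T).hom).torsion n).hom ≫
      (specOver k T).hom))).inv ≫ pointAlong (specOver k T).hom
      (((AbelianScheme.ofAbelianVariety A).toOver.baseChange (specOver k T).hom).torsion n).hom y)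
    ((isoSpecOver (Over.mk ((((AbelianScheme.ofAbelianVariety A).toOver.baseChange (specOver k T).hom).torsion n).hom ≫
      (specOver k T).hom))).inv ≫ s)
  have hy₁ : ((isoSpecOver (Over.mk ((((AbelianScheme.ofAbelianVariety A).toOver.baseChange (specOver k T).hom).torsion n).hom ≫
      (specOver k T).hom))).inv ≫ pointAlong (specOver k T).hom
      (((AbelianScheme.ofAbelianVariety A).toOver.baseChange (specOver k T).hom).torsion n).hom y) ≫ w = 1 := by
    rw [Category.assoc, Category.assoc, hy, MonObj.comp_one, MonObj.comp_one]
  rw [hy₁, cartierPairing_one_left, weilChar_eq] at h1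
  -- peel `ΓSpecIso`: the Weil unit over `Spec T₁` is `1`
  have h2 := (Scheme.ΓSpecIso (CommRingCat.of (Alg (Over.mk ((((AbelianScheme.ofAbelianVariety A).toOver.baseChange
      (specOver k T).hom).torsion n).hom ≫ (specOver k T).hom))))).commRingCatIsoToRingEquiv.injective
    ((map_one _).trans h1)
  -- move it to the base `Spec T₁ → T′ → Spec k` (same underlying data) and read it over `T′` by base change along the iso `t`
  have h3 := D.weilUnit_baseChange hD n
    ((((AbelianScheme.ofAbelianVariety A).toOver.baseChange (specOver k T).hom).torsion n).hom ≫ (specOver k T).hom)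
    (pointAlong (specOver k T).hom (((AbelianScheme.ofAbelianVariety A).toOver.baseChange (specOver k T).hom).torsion n).hom (y ≫ ĵ))
    (pointAlong_pow_eq_one _ _ _ (comp_pow_eq_one' n A D Ĝ ĵ hĜ y))
    (isoSpecOver (Over.mk ((((AbelianScheme.ofAbelianVariety A).toOver.baseChange (specOver k T).hom).torsion n).hom ≫
      (specOver k T).hom))).inv.left
    ⟨(AbelianScheme.ofAbelianVariety A).toOver.torsionTautSection' n (specOver k T).hom, hx₀⟩
  have hbase : (isoSpecOver (Over.mk ((((AbelianScheme.ofAbelianVariety A).toOver.baseChange (specOver k T).hom).torsion n).hom ≫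
      (specOver k T).hom))).inv.left ≫
      (((AbelianScheme.ofAbelianVariety A).toOver.baseChange (specOver k T).hom).torsion n).hom ≫ (specOver k T).hom =
      (specOver k (Alg (Over.mk ((((AbelianScheme.ofAbelianVariety A).toOver.baseChange (specOver k T).hom).torsion n).hom ≫
        (specOver k T).hom)))).hom :=
    Over.w (isoSpecOver (Over.mk ((((AbelianScheme.ofAbelianVariety A).toOver.baseChange (specOver k T).hom).torsion n).hom ≫
      (specOver k T).hom))).inv
  have h4 := D.weilUnit_congr_base hD n hbase
    (pointAlong ((((AbelianScheme.ofAbelianVariety A).toOver.baseChange (specOver k T).hom).torsion n).hom ≫ (specOver k T).hom)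
      (isoSpecOver (Over.mk ((((AbelianScheme.ofAbelianVariety A).toOver.baseChange (specOver k T).hom).torsion n).hom ≫
        (specOver k T).hom))).inv.left
      (pointAlong (specOver k T).hom (((AbelianScheme.ofAbelianVariety A).toOver.baseChange (specOver k T).hom).torsion n).hom (y ≫ ĵ)))
    (pointAlong_pow_eq_one _ _ _ (pointAlong_pow_eq_one _ _ _ (comp_pow_eq_one' n A D Ĝ ĵ hĜ y)))
    (((isoSpecOver (Over.mk ((((AbelianScheme.ofAbelianVariety A).toOver.baseChange (specOver k T).hom).torsion n).hom ≫
      (specOver k T).hom))).inv ≫ pointAlong (specOver k T).hom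
      (((AbelianScheme.ofAbelianVariety A).toOver.baseChange (specOver k T).hom).torsion n).hom y) ≫ ĵ)
    (comp_pow_eq_one' n A D Ĝ ĵ hĜ _) (by simp only [pointAlong, Over.comp_left, Over.homMk_left, Category.assoc])
    ((AbelianScheme.ofAbelianVariety A).toOver.torsionSectionAlong n
      ((((AbelianScheme.ofAbelianVariety A).toOver.baseChange (specOver k T).hom).torsion n).hom ≫ (specOver k T).hom)
      (isoSpecOver (Over.mk ((((AbelianScheme.ofAbelianVariety A).toOver.baseChange (specOver k T).hom).torsion n).hom ≫
        (specOver k T).hom))).inv.left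
      ⟨(AbelianScheme.ofAbelianVariety A).toOver.torsionTautSection' n (specOver k T).hom, hx₀⟩)
    ((AbelianScheme.ofAbelianVariety A).toOver.ptTorsionSection n (specOver k (Alg (Over.mk
      ((((AbelianScheme.ofAbelianVariety A).toOver.baseChange (specOver k T).hom).torsion n).hom ≫ (specOver k T).hom)))).hom
      (((isoSpecOver (Over.mk ((((AbelianScheme.ofAbelianVariety A).toOver.baseChange (specOver k T).hom).torsion n).hom ≫
        (specOver k T).hom))).inv ≫ s) ≫ j) (comp_pow_eq_one n A G j hG _))
    (by
      rw [coe_torsionSectionAlong, coe_ptTorsionSection, ptSection_left_fst, sectionAlong_left_fst, Category.assoc _ s j, hs,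
        Over.comp_left, sectionToPointHom_left])
  rw [h4, ← h2] at h3
  -- `t` is an isomorphism, so `t.appTop` detects `1`
  have h5 := congrArg (fun v => (inv (isoSpecOver (Over.mk ((((AbelianScheme.ofAbelianVariety A).toOver.baseChange
      (specOver k T).hom).torsion n).hom ≫ (specOver k T).hom))).inv.left).appTop v) h3
  simp only [map_one] at h5
  rw [← CommRingCat.comp_apply, ← Scheme.Hom.comp_appTop, IsIso.inv_hom_id, Scheme.Hom.id_appTop] at h5
  exact h5.symm

/-! ## §4 Trivial kernel on all points; `w` is a monomorphism -/

omit [IsMonHom j] in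
include hG hĜ in
/-- **Trivial kernel on ALL `T`-points** (finite points suffice: `Ĝ → Spec k` is finite and `G^D → Spec k` separated, ★ `comp_eq_one_of_forall_finite`).
[cite: MumfordAV1970, §20 (p. 184)] [cite: GortzWedhorn2020, Definition 4.45 (2), p. 117] -/
theorem eq_one_of_comp_weilHom_eq_one' (hn : n ≠ 0) [Mono ĵ] (w : Ĝ ⟶ cartierDual G)
    (hw : ∀ ⦃T : Type u⦄ [CommRing T] [Algebra k T] [Module.Finite k T] (y : specOver k T ⟶ Ĝ) (x : specOver k T ⟶ G),
      cartierPairing G (y ≫ w) x =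
        D.weilChar hD n (y ≫ ĵ) (comp_pow_eq_one' n A D Ĝ ĵ hĜ y) (x ≫ j) (comp_pow_eq_one n A G j hG x))
    ⦃T : SchemeOver k⦄ (y : T ⟶ Ĝ) (hy : y ≫ w = 1) : y = 1 :=
  haveI : IsFinite Ĝ.hom := isFinite_hom_of_finite_alg Ĝ
  comp_eq_one_of_forall_finite w (fun _ _ _ _ y' hy' => eq_one_of_comp_weilHom_eq_one n A D hD G j hG Ĝ ĵ hĜ hn w hw y' hy') y hy

omit [IsMonHom j] in
include hD hG hĜ in
/-- **THE WEIL HOMOMORPHISM IS A MONOMORPHISM** (`n ≠ 0`; ★ `mono_of_forall_comp_eq_one`). [cite: MumfordAV1970, §20 (p. 184)]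
[cite: GortzWedhorn2020, Definition 4.45 (2), p. 117] -/
theorem mono_weilHom (hn : n ≠ 0) [Mono ĵ] (w : Ĝ ⟶ cartierDual G) [IsMonHom w]
    (hw : ∀ ⦃T : Type u⦄ [CommRing T] [Algebra k T] [Module.Finite k T] (y : specOver k T ⟶ Ĝ) (x : specOver k T ⟶ G),
      cartierPairing G (y ≫ w) x =
        D.weilChar hD n (y ≫ ĵ) (comp_pow_eq_one' n A D Ĝ ĵ hĜ y) (x ≫ j) (comp_pow_eq_one n A G j hG x)) :
    Mono w :=
  mono_of_forall_comp_eq_one w (eq_one_of_comp_weilHom_eq_one' n A D hD G j hG Ĝ ĵ hĜ hn w hw)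

end Setting

/-! ## §5 Naturality in homomorphisms `φ : A → B` ((σ1-e)): `βd ≫ w_A = w_B ≫ β^D` -/

section Natural

variable (n : ℕ) (A B : AbelianVariety k)
  (DA : (AbelianScheme.ofAbelianVariety A).toOver.DualPair) (DB : (AbelianScheme.ofAbelianVariety B).toOver.DualPair)
  (hDA : Nonempty ((Scheme.Modules.pullback (DualPair.unitHatSlice DA)).obj DA.P ≅ SheafOfModules.unit _))
  (hDB : Nonempty ((Scheme.Modules.pullback (DualPair.unitHatSlice DB)).obj DB.P ≅ SheafOfModules.unit _))
  (φ : A ⟶ B)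
  (GA : SchemeOver k) [GrpObj GA] [IsCommMonObj GA] [IsAffine GA.left] [Module.Free k (Alg GA)] [Module.Finite k (Alg GA)]
  (jA : GA ⟶ A.X)
  (hGA : ∀ ⦃T : SchemeOver k⦄ (t : T ⟶ A.X), (∃ s : T ⟶ GA, s ≫ jA = t) ↔ t ≫ ((((n : ℕ) : ℤ) • 𝟙 A).hom.hom.hom) = 1)
  (ĜA : SchemeOver k) (ĵA : ĜA ⟶ DA.hat.X)
  (hĜA : ∀ ⦃T : SchemeOver k⦄ (t : T ⟶ DA.hat.X),
    (∃ s : T ⟶ ĜA, s ≫ ĵA = t) ↔ t ≫ ((((n : ℕ) : ℤ) • 𝟙 DA.hat.toAffine.toAbelianVariety).hom.hom.hom) = 1)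
  (GB : SchemeOver k) [GrpObj GB] [IsCommMonObj GB] [IsAffine GB.left] [Module.Free k (Alg GB)] [Module.Finite k (Alg GB)]
  (jB : GB ⟶ B.X)
  (hGB : ∀ ⦃T : SchemeOver k⦄ (t : T ⟶ B.X), (∃ s : T ⟶ GB, s ≫ jB = t) ↔ t ≫ ((((n : ℕ) : ℤ) • 𝟙 B).hom.hom.hom) = 1)
  (ĜB : SchemeOver k) [IsAffine ĜB.left] [Module.Finite k (Alg ĜB)] (ĵB : ĜB ⟶ DB.hat.X)
  (hĜB : ∀ ⦃T : SchemeOver k⦄ (t : T ⟶ DB.hat.X),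
    (∃ s : T ⟶ ĜB, s ≫ ĵB = t) ↔ t ≫ ((((n : ℕ) : ℤ) • 𝟙 DB.hat.toAffine.toAbelianVariety).hom.hom.hom) = 1)
  (β : GA ⟶ GB) [IsMonHom β] (hβ : β ≫ jB = jA ≫ φ.hom.hom.hom)
  (βd : ĜB ⟶ ĜA)
  (hβd : βd ≫ ĵA = ĵB ≫ dualIsogenyOver (A' := (AbelianScheme.ofAbelianVariety A).toOver)
    (B := (AbelianScheme.ofAbelianVariety B).toOver) φ.hom.hom.hom DA DB)
  (wA : ĜA ⟶ cartierDual GA)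
  (hwA : ∀ ⦃T : Type u⦄ [CommRing T] [Algebra k T] [Module.Finite k T] (y : specOver k T ⟶ ĜA) (x : specOver k T ⟶ GA),
    cartierPairing GA (y ≫ wA) x =
      DA.weilChar hDA n (y ≫ ĵA) (comp_pow_eq_one' n A DA ĜA ĵA hĜA y) (x ≫ jA) (comp_pow_eq_one n A GA jA hGA x))
  (wB : ĜB ⟶ cartierDual GB)
  (hwB : ∀ ⦃T : Type u⦄ [CommRing T] [Algebra k T] [Module.Finite k T] (y : specOver k T ⟶ ĜB) (x : specOver k T ⟶ GB),
    cartierPairing GB (y ≫ wB) x =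
      DB.weilChar hDB n (y ≫ ĵB) (comp_pow_eq_one' n B DB ĜB ĵB hĜB y) (x ≫ jB) (comp_pow_eq_one n B GB jB hGB x))

include hβ hβd hwA hwB in
/-- **NATURALITY OF THE WEIL HOMOMORPHISM: `βd ≫ w_A = w_B ≫ β^D`** for a homomorphism `φ : A → B`, lifts `β : G_A → G_B` of `φ` and `βd : Ĝ_B → Ĝ_A` of the
dual homomorphism `φ^∨` (★ `dualIsogenyOver`), dual pairs with the unit hypotheses.  Both sides are homs `Ĝ_B → G_A^D`; their pairing values at finite
points `(y, x)` are `e_n^A(x, φ^∨(ŷ))` and — by the adjunction `⟪t ≫ β^D, x⟫ = ⟪t, x ≫ β⟫` (★ `cartierPairing_comp_cartierDualMap`) — `e_n^B(φ(x), ŷ)`, which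
agree by ★ (σ1-e) `weilUnit_comp_dualIsogenyOver` («`e_n^A(x, φ^∨ŷ) = e_n^B(φx, ŷ)`», [MumfordAV1970] §20 (I) p. 186); conclude by ★ `hom_cartierDual_ext_of_finite`.
[cite: MumfordAV1970, §20 (p. 186), §15 Thm. 1 (p. 143)] [cite: Tate1997FiniteFlatGroupSchemes, §(3.8) p. 145] -/
theorem weilHom_natural : βd ≫ wA = wB ≫ cartierDualMap β := by
  haveI : IsFinite ĜB.hom := isFinite_hom_of_finite_alg ĜB
  refine hom_cartierDual_ext_of_finite GA (Y := ĜB) fun T _ _ _ y x => ?_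
  haveI : IsLocallyNoetherian (Spec (CommRingCat.of T)) := isLocallyNoetherian_spec_of_finite (k := k) T
  haveI : IsLocallyNoetherian (specOver k T).left := ‹IsLocallyNoetherian (Spec (CommRingCat.of T))›
  haveI : IsCommMonObj ((AbelianScheme.ofAbelianVariety A).toOver.baseChange (specOver k T).hom).X :=
    isCommMonObj_baseChange_of_field _
  haveI : IsCommMonObj ((AbelianScheme.ofAbelianVariety B).toOver.baseChange (specOver k T).hom).X :=
    isCommMonObj_baseChange_of_field _
  rw [← Category.assoc, hwA (y ≫ βd) x, ← Category.assoc, cartierPairing_comp_cartierDualMap, hwB y (x ≫ β), weilChar_eq, weilChar_eq]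
  have e1 : (y ≫ βd) ≫ ĵA = (y ≫ ĵB) ≫ dualIsogenyOver (A' := (AbelianScheme.ofAbelianVariety A).toOver)
      (B := (AbelianScheme.ofAbelianVariety B).toOver) φ.hom.hom.hom DA DB := by
    rw [Category.assoc, hβd, Category.assoc]
  have hc' : ((y ≫ ĵB) ≫ dualIsogenyOver (A' := (AbelianScheme.ofAbelianVariety A).toOver) (B := (AbelianScheme.ofAbelianVariety B).toOver)
      φ.hom.hom.hom DA DB) ^ n = 1 := by
    rw [← e1]; exact comp_pow_eq_one' n A DA ĜA ĵA hĜA (y ≫ βd)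
  rw [DA.weilUnit_congr_point hDA n (specOver k T).hom e1 _ hc',
    @DualPair.weilUnit_comp_dualIsogenyOver _ (AbelianScheme.ofAbelianVariety A).toOver (AbelianScheme.ofAbelianVariety B).toOver _ _
      φ.hom.hom.hom φ.hom.hom.isMonHom_hom DA DB hDA hDB n _ (specOver k T).hom (y ≫ ĵB) (comp_pow_eq_one' n B DB ĜB ĵB hĜB y) _ _ _ hc']
  congr 2
  apply Subtype.ext
  simp only [coe_ptTorsionSection, ptSection_comp_baseChangeHom, Category.assoc, hβ]

end Natural

end Literature.AlgebraicGeometry.AbelianSchemes.WeilPairing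

end
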